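import Literature.AlgebraicGeometry.Motives.WeilSignatureLinearAlgebra
import Literature.AlgebraicGeometry.Motives.SegreHyperplaneClass
import Literature.AlgebraicGeometry.Motives.AimedSplitProductCMSquare
import Literature.AlgebraicGeometry.Motives.HyperbolicWeilTypeProductModel
import Literature.AlgebraicGeometry.Motives.WeilFormIsotropicBlockVectorsAll
import Literature.AlgebraicGeometry.Motives.RationalDegreeOneModel
import Literature.AlgebraicGeometry.Motives.RationalDegreeOneModelWeilType
import Literature.AlgebraicGeometry.Motives.AbelianVarietyProductDimProofs
import Literature.AlgebraicGeometry.Motives.AbelianVarietyCohomologyExteriorH1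
import Literature.AlgebraicGeometry.HodgeTheory.WeilSurfaceCMSquareModel
import Literature.AlgebraicGeometry.HodgeTheory.WeilClassesHodgeType
import Literature.AlgebraicGeometry.HodgeTheory.HodgeRiemannDegreeOneProofs
import Literature.AlgebraicGeometry.HodgeTheory.ComplexConjugation
import HarnessLib

/-!
# Aimed split products with the CM Weil surface — the discharge of `exists_cmWeilSurface_aimedSplitProduct_of_ne_one_of_ne_three`

Layer `Literature/AlgebraicGeometry/Motives`; theorems-only companion of `Motives/AimedSplitProduct`
(the named fact `exists_cmWeilSurface_aimedSplitProduct_of_ne_one_of_ne_three`, the AIMING LEMMA of the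
product trick for abelian varieties of Weil type: E. Markman, arXiv:2509.23403 §11.5 Step 2, "for every
polarized abelian fourfold `(A₁,η₁,h₁)` of Weil type, of arbitrary discriminant, there exists a polarized
abelian surface of Weil type `(A₂,η₂,h₂)`, such that the discriminant of their product … is the coset of
`-1`. The sixfold is hence of split type"; B. van Geemen, LNM 1594 (1994), Lemma 5.2 (2)–(6), 5.3, 5.4
(5.4.1); C. Schoen, Compositio 114 (1998) §10) and of `Motives/AimedSplitProductCMSquare` (which reduced
the fact to the aiming (AIM) of the CM squares `A × (E₀ × E₀)`,
`exists_cmWeilSurface_aimedSplitProduct_of_ne_one_of_ne_three_of_exists_aimedCmCurve`, the CM curve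
`E₀ = ℂ/(ℤ + ℤ√-d)` with `[√-d]` being the tree's `CMEndomorphism.exists_cmCurve_sqrt_neg`). This file
PROVES (AIM) for every `d ≥ 1` and closes the fact:

* `weilSignature_exists_PN` — van Geemen's Lemma 5.2 (4)–(5) on the carriers: from Hodge–Riemann in
  degree one WITH SIGN for the `K`-symmetric hyperplane class `h` (the tree's
  `HodgeTheory.hodgeRiemann_degreeOne(_of_isOfHodgeType)`, Voisin I Thm. 6.32 at `k = 1`) and
  `K`-multiplicities `(n, n)`, the symmetric rational form `S(v, w) = v ⬝ G_A (M_A w)` of a rational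
  degree-one model `(u, M_A, ω, G_A)` of `(A, φ, h)` is positive definite on an `M_A`-stable rational
  `2n`-space `P` and negative definite on such an `N` (linear algebra in `Motives/WeilSignatureLinearAlgebra`);
* `weilMultiplicity_of_mem_weilClassesOf` — the `K`-multiplicities `(n, n)` of `φ^*` on `H^{1,0}` from a
  non-zero `(n,n)` class of the Weil plane (Deligne–Milne Prop. 4.4 / van Geemen 5.2 (6), the tree's
  `HodgeTheory.finrank_eq_of_mem_weilClassesOf`, and conjugation `q_{μ̄} = p_μ`);
* `af_weilModel`, `af_product_symm`, `af_partner_symm` — bookkeeping of the two rational degree-one models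
  fed to `Motives.exists_isotropic_blockVectors'` (the Hasse-free arithmetic: every class `-q` is a
  discriminant of `m₁E₀ ⊞ m₂E₀`, Landherr) and `Motives.isHyperbolicWeilType_prod_of_rationalModels`
  (the frame transport, `det H` multiplicative);
* `aimedSplitProduct_cmSquare_of_pos` — **(AIM) for `n ≥ 1`**: for the CM curve `(E₀, ψ₀)`,
  `ψ₀ ≫ ψ₀ = -d` (its model `(v, ψ₀^*v)`, `M_E = ((0,-d),(1,0))`, `G_E = ((0,1),(-1,0))`,
  `HodgeTheory.cmCurve_rationalModel`) and every `(A, φ)` of dimension `2n` with a non-zero rational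
  `(n,n)` class in its Weil plane, the product `A × (E₀ × E₀)` with `φ × (ψ₀ × (-ψ₀))` carries a projective
  embedding `e` (the `K`-symmetric weighted Segre embedding of `Motives/SegreHyperplaneClass`) and a
  rational `a ≠ 0` making it of HYPERBOLIC Weil type in half-dimension `n + 1` for the `K`-symmetrised
  hyperplane class `d·e^*a + (φ × ψ)^*e^*a = 2d·e^*a`;
* `aimedSplitProduct_cmSquare_of_dim_eq_zero` — **(AIM) for `n = 0`** (`A` a point): the CM square
  alone with an equal-weight embedding is hyperbolic, the isotropic `K`-line `{(v, v), (Mv, -Mv)}`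
  (van Geemen 5.3 with `a = 1`), transported to `A × (E₀ × E₀)` along `pr_{E₀×E₀}`
  (`isHyperbolicWeilType_prod_of_dim_eq_zero`);
* `exists_aimedCmCurve`, `exists_cmWeilSurface_aimedSplitProduct_of_ne_one_of_ne_three_holds` — the
  discharge.

Provenance: the `n ≥ 1` assembly, the signature stub and the model bookkeeping first landed on the summit
side for `d = 7` (route `HeckePrymWeil` of the Hodge summit, files
`Theorems/HeckePrymWeilWeilTwelvefoldsSqrtMinus7{WeilSignature,AimedFrameLemmas,AimedFrame}`, same
statements and proofs); re-hosted and generalised to every `d ≥ 1` here because the discharge of a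
Literature fact cannot import `Summits` (CONVENTIONS §2). Everything is proved; no definition and no
named fact is introduced (D-0026).

## References

* [Markman2025SurveySecant] E. Markman, arXiv:2509.23403, §11.5 Step 2.
* [vanGeemen1994HodgeAV] B. van Geemen, An introduction to the Hodge conjecture for abelian
  varieties, LNM 1594 (1994), 4.9, Lemma 5.2 (2)–(6), 5.3, 5.4 (5.4.1).
* [Schoen1998HodgeWeilAddendum] C. Schoen, Compositio Math. 114 (1998), §10.
* [Deligne1982HodgeCycles] P. Deligne (notes by J. S. Milne), Hodge cycles on abelian varieties,
  LNM 900 (1982), Prop. 4.4.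
* [VoisinHodgeI2002] C. Voisin, Hodge Theory and Complex Algebraic Geometry I (2002), Thm. 6.32, Cor. 6.12.
* [LangeBirkenhake1992] H. Lange, Ch. Birkenhake, Complex Abelian Varieties (1992), Lemma 1.1.17, §5.3.
* [SilvermanAEC2009] J. Silverman, The Arithmetic of Elliptic Curves (2009), Thm. VI.4.1 (b).
-/

noncomputable section

open CategoryTheory Complex
open scoped Matrix
open Literature.AlgebraicGeometry Literature.AlgebraicGeometry.HodgeTheory
  Literature.AlgebraicTopology.SingularHomology
open Literature.Geometry.Kaehler

namespace Literature.AlgebraicGeometry.Motives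

/-! ## Index bookkeeping for `H^{1,0}` -/

/-- The subspace `H^{1,0} ⊆ H¹(X(ℂ); ℂ)` does not depend on how the dimension index is written
(`2n` versus `(2n - 1) + 1`). [folklore] -/
theorem hodgeOneZero_eq_of_eq {X : SchemeOver ℂ} {N N' : ℕ} (hX : IsSmoothProjective N X)
    (hX' : IsSmoothProjective N' X) (e : N = N') : hodgeOneZero hX = hodgeOneZero hX' := by
  subst e; rfl

/-! ## Weil multiplicities `(n, n)` from a Weil class (Deligne–Milne Prop. 4.4) -/

/-- **The `K`-multiplicities of a Weil pair carrying a non-zero `(n,n)` Weil class are `(n, n)`**: for a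
complex abelian `2n`-fold `(A, φ)` (`n ≥ 1`), `φ ≫ φ = -d` (`d ≥ 1`), if the Weil plane
`weilClassesOf A φ n d ⊆ H²ⁿ(A(ℂ); ℂ)` contains a class `c ≠ 0` of Hodge type `(n, n)`, then both
eigenvalues `± i√d` of `φ^*` have multiplicity `n` on `H^{1,0}(A)` (Deligne–Milne Prop. 4.4, "only if",
the tree's `finrank_eq_of_mem_weilClassesOf`, gives `dim (V₊ ∩ H^{1,0}) = n`; then
`dim (V₊ ∩ H^{0,1}) = 2n - n = n` and conjugation, `finrank_eigenspace_inf_hodgeZeroOne_eq`, gives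
`dim (V₋ ∩ H^{1,0}) = dim (V₊ ∩ H^{0,1}) = n`). [cite: Deligne1982HodgeCycles, Prop. 4.4]
[cite: vanGeemen1994HodgeAV, 4.9–4.10 and Lemma 5.2 (6)] -/
theorem weilMultiplicity_of_mem_weilClassesOf {n d : ℕ} (hn : 0 < n) (hd : 0 < d)
    {A : AbelianVariety ℂ} {φ : A ⟶ A} (hA : A.dim = 2 * n) (hφ : φ ≫ φ = -(d • 𝟙 A))
    {c : complexBetti A.X (2 * n)} (hc : c ∈ weilClassesOf A φ n d) (hc0 : c ≠ 0)
    (hH : IsOfHodgeType (2 * n) A.X (2 * n) n n c) :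
    Module.finrank ℂ ↥(Module.End.eigenspace (complexBetti.map φ.hom.hom.hom 1).hom
          (Complex.I * (Real.sqrt (d : ℝ) : ℂ)) ⊓ hodgeOneZero (isSmoothProjective_of_dim_eq' hA)) = n ∧
    Module.finrank ℂ ↥(Module.End.eigenspace (complexBetti.map φ.hom.hom.hom 1).hom
          (-(Complex.I * (Real.sqrt (d : ℝ) : ℂ))) ⊓ hodgeOneZero (isSmoothProjective_of_dim_eq' hA)) = n := by
  haveI := finite_complexBetti_abelianVariety A 1
  have ha : Module.finrank ℂ ↥(Module.End.eigenspace (complexBetti.map φ.hom.hom.hom 1).hom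
      (Complex.I * (Real.sqrt (d : ℝ) : ℂ)) ⊓ hodgeOneZero (isSmoothProjective_of_dim_eq' hA)) = n :=
    finrank_eq_of_mem_weilClassesOf hn hA hd hφ hc hc0 hH
  have hab := finrank_inf_hodgeOneZero_add_finrank_inf_hodgeZeroOne hA hd hφ
  rw [ha] at hab
  have hb : Module.finrank ℂ ↥(Module.End.eigenspace (complexBetti.map φ.hom.hom.hom 1).hom
      (Complex.I * (Real.sqrt (d : ℝ) : ℂ)) ⊓ hodgeZeroOne (isSmoothProjective_of_dim_eq' hA)) = n := by omega
  have hconj : (starRingEnd ℂ) (-(Complex.I * (Real.sqrt (d : ℝ) : ℂ))) = Complex.I * (Real.sqrt (d : ℝ) : ℂ) := by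
    rw [map_neg, map_mul, Complex.conj_I, Complex.conj_ofReal]; ring
  have h := finrank_eigenspace_inf_hodgeZeroOne_eq (isSmoothProjective_of_dim_eq' hA) φ.hom.hom.hom
    (-(Complex.I * (Real.sqrt (d : ℝ) : ℂ)))
  rw [hconj, hb] at h
  exact ⟨ha, h.symm⟩

/-! ## The signature `(n, n)` of the rational degree-one model (van Geemen 5.2 (4)–(5)) -/

/-- **The signature `(n, n)` of the rational degree-one model of a `K`-symmetrically polarized Weil pair**
(van Geemen, LNM 1594, Lemma 5.2 (4)–(5), on the carriers, in the EXACT shape `hPN` consumed by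
`Motives.exists_isotropic_blockVectors'`). Data: `(A, φ)` of dimension `j + 1`, `φ ≫ φ = -d`; the
eigenvalues `± i√d` of `φ^*` have multiplicity `n` on `H^{1,0}`; a class `h` with `φ^* h = d h` satisfying
Hodge–Riemann in degree one (`i · h^j ⌣ x ⌣ x̄ ∈ ℝ_{>0} · ω₀` on `H^{1,0} ∖ 0`, the shape of
`hodgeRiemann_degreeOne_of_isOfHodgeType`); a rational degree-one model `(u, M_A, ω, G_A)` of `(A, φ, h)`.
Conclusion: `S(v, w) = v ⬝ G_A (M_A w)` is positive definite on an `M_A`-stable rational `2n`-space `P` and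
negative definite on such an `N`, `P ⊓ N = 0`. Proof: coordinates in the rational basis (`φ^*` acts by
`M_A`, `Q_h` is `(x ⬝ G_A y) ω`, conjugation is coordinatewise, `M_A² = -d`; `G_A` alternating
`gram_antisymm` and of Weil type `gram_map_eq_mul_gram`), van Geemen's Hermitian form is definite of opposite
signs on `V₊^{1,0} ⊕ V₋^{0,1}` and `V₋^{1,0} ⊕ V₊^{0,1}` (`weilSig_exists_Zp_Zn`; the Hodge–Riemann class
`ω₀` is a REAL multiple of `ω` since both are rational), and rational definite `M_A`-stable subspaces are
built one `K`-line at a time (`weilSig_exists_PN`).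
[cite: vanGeemen1994HodgeAV, Lemma 5.2 (2), (4), (5) with proof] -/
theorem weilSignature_exists_PN {j d : ℕ} (hd : 0 < d) {A : AbelianVariety ℂ} {φ : A ⟶ A}
    (hA : A.dim = j + 1) (hφ : φ ≫ φ = -(d • 𝟙 A)) {n : ℕ}
    (hVp : Module.finrank ℂ ↥(Module.End.eigenspace (complexBetti.map φ.hom.hom.hom 1).hom
            (Complex.I * (Real.sqrt (d : ℝ) : ℂ)) ⊓ hodgeOneZero (isSmoothProjective_of_dim_eq' hA)) = n)
    (hVm : Module.finrank ℂ ↥(Module.End.eigenspace (complexBetti.map φ.hom.hom.hom 1).hom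
            (-(Complex.I * (Real.sqrt (d : ℝ) : ℂ))) ⊓ hodgeOneZero (isSmoothProjective_of_dim_eq' hA)) = n)
    {h : complexBetti A.X 2} (hφh : complexBetti.map φ.hom.hom.hom 2 h = (d : ℂ) • h)
    (hHR : ∃ ω₀ : complexBetti A.X (2 + 2 * j), IsRationalClass ω₀ ∧ ω₀ ≠ 0 ∧
        ∀ x : complexBetti A.X 1, IsOfHodgeType (j + 1) A.X 1 1 0 x → x ≠ 0 →
          ∃ t : ℝ, 0 < t ∧
            Complex.I • polarizationPairingOne A.X h j x (conjClass (ComplexPoints A.X) 1 x) = (t : ℂ) • ω₀)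
    {ι : Type} [Fintype ι] [DecidableEq ι] (u : ι → complexBetti A.X 1)
    (hu : ∀ i, IsRationalClass (u i)) (hind : LinearIndependent ℂ u) (hspan : Submodule.span ℂ (Set.range u) = ⊤)
    (MA : Matrix ι ι ℚ) (hMAu : ∀ i, complexBetti.map φ.hom.hom.hom 1 (u i) = ∑ k, ((MA k i : ℚ) : ℂ) • u k)
    (ω : complexBetti A.X (2 + 2 * j)) (GA : Matrix ι ι ℚ) (hω : IsRationalClass ω) (hω0 : ω ≠ 0)
    (hG : ∀ i k, polarizationPairingOne A.X h j (u i) (u k) = ((GA i k : ℚ) : ℂ) • ω) :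
    ∃ P N : Submodule ℚ (ι → ℚ), (∀ v ∈ P, MA.mulVec v ∈ P) ∧ (∀ v ∈ N, MA.mulVec v ∈ N) ∧
      Module.finrank ℚ P = 2 * n ∧ Module.finrank ℚ N = 2 * n ∧ P ⊓ N = ⊥ ∧
      (∀ x ∈ P, x ≠ 0 → 0 < x ⬝ᵥ GA.mulVec (MA.mulVec x)) ∧
      (∀ x ∈ N, x ≠ 0 → x ⬝ᵥ GA.mulVec (MA.mulVec x) < 0) := by
  classical
  -- the degenerate case `n = 0`
  rcases Nat.eq_zero_or_pos n with hn0 | hn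
  · subst hn0
    refine ⟨⊥, ⊥, fun v hv => ?_, fun v hv => ?_, by simp, by simp, by simp, fun x hx hx0 => ?_,
      fun x hx hx0 => ?_⟩
    · rw [(Submodule.mem_bot ℚ).1 hv, Matrix.mulVec_zero]; exact Submodule.zero_mem _
    · rw [(Submodule.mem_bot ℚ).1 hv, Matrix.mulVec_zero]; exact Submodule.zero_mem _
    · exact absurd ((Submodule.mem_bot ℚ).1 hx) hx0
    · exact absurd ((Submodule.mem_bot ℚ).1 hx) hx0
  -- notation
  have hX : IsSmoothProjective (j + 1) A.X := isSmoothProjective_of_dim_eq' hA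
  haveI : Module.Finite ℂ (complexBetti A.X 1) := finite_complexBetti_abelianVariety A 1
  set T : complexBetti A.X 1 →ₗ[ℂ] complexBetti A.X 1 := (complexBetti.map φ.hom.hom.hom 1).hom with hT_def
  set Q := polarizationPairingOne A.X h j with hQ_def
  set κ : complexBetti A.X 1 → complexBetti A.X 1 := conjClass (ComplexPoints A.X) 1 with hκ_def
  set H10 : Submodule ℂ (complexBetti A.X 1) := hodgeOneZero hX with hH10_def
  set H01 : Submodule ℂ (complexBetti A.X 1) := hodgeZeroOne hX with hH01_def
  have hdQ : (0 : ℚ) < d := by exact_mod_cast hd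
  -- the rational basis `u` and coordinates
  let b : Module.Basis ι ℂ (complexBetti A.X 1) := Module.Basis.mk hind hspan.ge
  have hbu : ⇑b = u := Module.Basis.coe_mk _ _
  set β : complexBetti A.X 1 ≃ₗ[ℂ] (ι → ℂ) := b.equivFun with hβ_def
  have hTb : ∀ i, T (b i) = ∑ k, ((MA k i : ℚ) : ℂ) • b k := fun i => by rw [hbu]; exact hMAu i
  have hQb : ∀ i k, Q (b i) (b k) = ((GA i k : ℚ) : ℂ) • ω := fun i k => by rw [hbu]; exact hG i k
  have hbrat : ∀ i, IsRationalClass (b i) := fun i => by rw [hbu]; exact hu i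
  have hβT : ∀ x, β (T x) = (MA.map (algebraMap ℚ ℂ)).mulVec (β x) := weilSig_equivFun_map b hTb
  have hβQ : ∀ x y, Q x y = (β x ⬝ᵥ (GA.map (algebraMap ℚ ℂ)).mulVec (β y)) • ω := weilSig_pairing_eq b hQb
  have hβκ : ∀ x, β (κ x) = star (β x) := weilSig_equivFun_conjClass b hbrat
  -- `(φ^*)² = -d`, hence `M_A² = -d`
  have hTT : ∀ x, T (T x) = -(((d : ℚ) : ℂ) • x) := fun x => by
    rw [Rat.cast_natCast]
    exact complexBetti_map_map_one_of_comp_self hφ x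
  have hMA : MA * MA = (-(d : ℚ)) • (1 : Matrix ι ι ℚ) := weilSig_matrix_sq b hTb hTT
  -- `G_A` is alternating and of Weil type
  have hGA : GA.transpose = -GA := by
    ext i k
    rw [Matrix.transpose_apply, Matrix.neg_apply]
    exact gram_antisymm h j u hω0 GA hG k i
  have hWt : MA.transpose * GA * MA = (d : ℚ) • GA := by
    ext i k
    have e := gram_map_eq_mul_gram hA (abelianVarietyCohomologyExteriorH1_holds.finrank_one A)
      (abelianVarietyCohomologyExteriorH1_holds.span_range_cupPowOne A _) hd hφ hφh u MA
      hMAu hω0 GA hG i k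
    rw [Matrix.smul_apply, smul_eq_mul, ← e]
    simp only [Matrix.mul_apply, Matrix.transpose_apply, Finset.sum_mul]
    rw [Finset.sum_comm]
  -- conjugation: commutes with `φ^*`, is conjugate-linear, swaps the Hodge pieces
  have hTκ : ∀ x, T (κ x) = κ (T x) := fun x => (conjClass_map _ x).symm
  have hκs : ∀ (c : ℂ) (x : complexBetti A.X 1), κ (c • x) = (starRingEnd ℂ) c • κ x :=
    fun c x => conjClass_smul c x
  have hκ01 : ∀ x ∈ H01, κ x ∈ H10 := fun x hx => conjClass_mem_hodgeOneZero hX hx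
  have hκ10 : ∀ x ∈ H10, κ x ∈ H01 := fun x hx => conjClass_mem_hodgeZeroOne hX hx
  -- the eigenvalue `s = i√d = √d · i`
  have hm : (0 : ℝ) < Real.sqrt d := Real.sqrt_pos.2 (by exact_mod_cast hd)
  have hm7 : Real.sqrt d * Real.sqrt d = ((d : ℚ) : ℝ) := by
    rw [Rat.cast_natCast]; exact Real.mul_self_sqrt (Nat.cast_nonneg d)
  have hs : Complex.I * (Real.sqrt (d : ℝ) : ℂ) = (Real.sqrt d : ℂ) * Complex.I := mul_comm _ _
  -- the Hodge–Riemann class `ω₀` is a real multiple `ρ ω` of `ω`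
  obtain ⟨ω₀, hω₀rat, hω₀0, hHRω⟩ := hHR
  have hne : Module.End.eigenspace T (Complex.I * (Real.sqrt (d : ℝ) : ℂ)) ⊓ H10 ≠ ⊥ := fun h0 => by
    rw [h0, finrank_bot] at hVp
    omega
  obtain ⟨x₀, hx₀, hx₀0⟩ := Submodule.exists_mem_ne_zero_of_ne_bot hne
  obtain ⟨t₀, ht₀, e₀⟩ := hHRω x₀ hx₀.2 hx₀0
  set ρc : ℂ := (t₀ : ℂ)⁻¹ * (Complex.I * (β x₀ ⬝ᵥ (GA.map (algebraMap ℚ ℂ)).mulVec (β (κ x₀)))) with hρc_def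
  have hω₀ : ω₀ = ρc • ω := by
    have ht0' : (t₀ : ℂ) ≠ 0 := by exact_mod_cast ht₀.ne'
    calc ω₀ = (t₀ : ℂ)⁻¹ • ((t₀ : ℂ) • ω₀) := by rw [smul_smul, inv_mul_cancel₀ ht0', one_smul]
      _ = ρc • ω := by rw [← e₀, hβQ, smul_smul, smul_smul, hρc_def, mul_assoc]
  have hρreal : (starRingEnd ℂ) ρc = ρc := by
    have h1 : conjClass (ComplexPoints A.X) _ ω₀ = ω₀ := hω₀rat.conjClass_eq
    rw [hω₀, conjClass_smul, hω.conjClass_eq] at h1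
    have h2 : ((starRingEnd ℂ) ρc - ρc) • ω = 0 := by rw [sub_smul, h1, sub_self]
    rcases smul_eq_zero.1 h2 with h3 | h3
    · exact sub_eq_zero.1 h3
    · exact absurd h3 hω0
  set ρ : ℝ := ρc.re with hρ_def
  have hρc : ρc = (ρ : ℂ) := (Complex.conj_eq_iff_re.1 hρreal).symm
  have hρ0 : ρ ≠ 0 := fun h0 => hω₀0 (by rw [hω₀, hρc, h0, Complex.ofReal_zero, zero_smul])
  have hHR' : ∀ x ∈ H10, x ≠ 0 → ∃ t : ℝ, 0 < t ∧ Complex.I • Q x (κ x) = ((t : ℂ) * ρ) • ω := by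
    intro x hx hx0
    obtain ⟨t, ht, e⟩ := hHRω x hx hx0
    exact ⟨t, ht, by rw [e, hω₀, hρc, smul_smul]⟩
  -- the two definite pieces and the rational definite subspaces
  obtain ⟨Zp, Zn, hZp, hZn, hpos, hneg⟩ := weilSig_exists_Zp_Zn T Q κ β hdQ hω0 hMA hGA hWt hβT hβQ hβκ hTκ
    hκs hm hm7 hs H10 H01 hκ01 hκ10 hVp hVm hρ0 hHR'
  exact weilSig_exists_PN hdQ hMA hGA hWt n Zp Zn hZp hZn hpos hneg

/-! ## Linear algebra of rational models -/

section LinearAlgebra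

/-- **The square of the model matrix from the square of the operator.** If `u` is a `ℂ`-linearly
independent family, `T uᵢ = Σⱼ M j i • uⱼ` for a rational matrix `M`, and `T (T uᵢ) = c • uᵢ`
(`c ∈ ℚ`), then `M² = c` on coordinate vectors: `M (M v) = c • v`. [folklore] -/
theorem af_mulVec_mulVec_of_frame {V : Type*} [AddCommGroup V] [Module ℂ V] {ι : Type*} [Fintype ι]
    [DecidableEq ι] (T : V →ₗ[ℂ] V) (u : ι → V) (hu : LinearIndependent ℂ u) (M : Matrix ι ι ℚ)
    (hM : ∀ i, T (u i) = ∑ j, ((M j i : ℚ) : ℂ) • u j) (c : ℚ)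
    (hT : ∀ i, T (T (u i)) = ((c : ℚ) : ℂ) • u i) (v : ι → ℚ) :
    M.mulVec (M.mulVec v) = c • v := by
  -- `(M * M) k i = c δ_{ki}`
  have hcoef : ∀ i k, (M * M) k i = if k = i then c else 0 := by
    intro i
    have h1 : T (T (u i)) = ∑ k, (((M * M) k i : ℚ) : ℂ) • u k := by
      rw [hM i, map_sum]
      simp only [map_smul, hM, Finset.smul_sum, smul_smul]
      rw [Finset.sum_comm]
      refine Finset.sum_congr rfl fun k _ => ?_
      rw [← Finset.sum_smul, Matrix.mul_apply]
      push_cast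
      refine congrArg (· • u k) (Finset.sum_congr rfl fun j _ => ?_)
      ring
    have h2 : ∑ k, ((((M * M) k i : ℚ) : ℂ) - if k = i then ((c : ℚ) : ℂ) else 0) • u k = 0 := by
      simp only [sub_smul, Finset.sum_sub_distrib, ite_smul, zero_smul, Finset.sum_ite_eq',
        Finset.mem_univ, if_true]
      rw [← h1, hT i, sub_self]
    intro k
    have h3 := Fintype.linearIndependent_iff.1 hu _ h2 k
    rw [sub_eq_zero] at h3
    by_cases hki : k = i
    · rw [if_pos hki] at h3 ⊢
      exact_mod_cast h3
    · rw [if_neg hki] at h3 ⊢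
      exact_mod_cast h3
  rw [Matrix.mulVec_mulVec]
  funext k
  simp only [Matrix.mulVec, dotProduct, Pi.smul_apply, smul_eq_mul]
  simp_rw [hcoef _ k]
  simp only [ite_mul, zero_mul, Finset.sum_ite_eq, Finset.mem_univ, if_true]

/-- **Weil type in bilinear form** from the entrywise identity `Σ_{a,b} M a i G a b M b k = d G i k`
(`Mᵀ G M = d G`): `(M v) ⬝ G (M w) = d · (v ⬝ G w)`. [folklore] -/
theorem af_weil_mulVec_of_entries {ι : Type*} [Fintype ι] (M G : Matrix ι ι ℚ) (d : ℚ)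
    (h : ∀ i k, ∑ a, ∑ b, M a i * G a b * M b k = d * G i k) (v w : ι → ℚ) :
    M.mulVec v ⬝ᵥ G.mulVec (M.mulVec w) = d * (v ⬝ᵥ G.mulVec w) := by
  have hMGM : M.transpose * G * M = d • G := by
    ext i k
    rw [Matrix.smul_apply, smul_eq_mul, ← h i k, Matrix.mul_apply, Finset.sum_comm]
    refine Finset.sum_congr rfl fun a _ => ?_
    rw [Matrix.mul_apply, Finset.sum_mul]
    refine Finset.sum_congr rfl fun b _ => ?_
    rw [Matrix.transpose_apply]
  calc M.mulVec v ⬝ᵥ G.mulVec (M.mulVec w)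
        = v ⬝ᵥ (M.transpose * G * M).mulVec w := by
          rw [← Matrix.vecMul_transpose, ← Matrix.dotProduct_mulVec, Matrix.mulVec_mulVec,
            Matrix.mulVec_mulVec, Matrix.mul_assoc]
      _ = d * (v ⬝ᵥ G.mulVec w) := by
          rw [hMGM, Matrix.smul_mulVec, dotProduct_smul, smul_eq_mul]

/-- **Alternation in bilinear form** from `G i k = -G k i`: `w ⬝ G v = -(v ⬝ G w)`. [folklore] -/
theorem af_antisymm_mulVec_of_entries {ι : Type*} [Fintype ι] (G : Matrix ι ι ℚ)
    (h : ∀ i k, G i k = -G k i) (v w : ι → ℚ) :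
    w ⬝ᵥ G.mulVec v = -(v ⬝ᵥ G.mulVec w) := by
  have hGt : G.transpose = -G := by
    ext i k
    rw [Matrix.transpose_apply, Matrix.neg_apply, h k i]
  rw [Matrix.dotProduct_mulVec, dotProduct_comm, ← Matrix.mulVec_transpose, hGt, Matrix.neg_mulVec,
    dotProduct_neg]

/-- The binary alternating Gram matrix `!![0, 1; -1, 0]` is alternating in bilinear form. [folklore] -/
theorem af_GE_antisymm (a b : Fin 2 → ℚ) :
    b ⬝ᵥ (!![0, 1; -1, 0] : Matrix (Fin 2) (Fin 2) ℚ).mulVec a =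
      -(a ⬝ᵥ (!![0, 1; -1, 0] : Matrix (Fin 2) (Fin 2) ℚ).mulVec b) :=
  af_antisymm_mulVec_of_entries _ (fun i k => by fin_cases i <;> fin_cases k <;> simp) a b

/-- The companion matrix `M_E = !![0, -d; 1, 0]` of `[√-d]^*` squares to `-d` on coordinate vectors.
[folklore] -/
theorem af_ME_mulVec_mulVec (d : ℚ) (v : Fin 2 → ℚ) :
    (!![(0 : ℚ), -d; 1, 0] : Matrix (Fin 2) (Fin 2) ℚ).mulVec
        ((!![(0 : ℚ), -d; 1, 0] : Matrix (Fin 2) (Fin 2) ℚ).mulVec v) = -(d • v) := by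
  funext i
  fin_cases i <;> simp [Matrix.mulVec, dotProduct, Fin.sum_univ_two]

end LinearAlgebra

/-! ## The two packaged models and the `K`-symmetrised product class -/

section Models

variable {A B : AbelianVariety ℂ}

/-- **The `K`-symmetrisation of the product class is multiplication by `d + d`**: for `K`-symmetric
classes `φ_A^* h_A = d h_A`, `ψ^* h_B = d h_B` on the factors,
`(φ_A × ψ)^*(pr_A^* h_A + pr_B^* h_B) = d · (pr_A^* h_A + pr_B^* h_B)`. [cite: Markman2025SurveySecant, §11.5 Step 2] -/
theorem af_product_symm {dC : ℂ} (φ : A ⟶ A) (ψ : B ⟶ B) {hA2 : complexBetti A.X 2}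
    {hB2 : complexBetti B.X 2} (hA : complexBetti.map φ.hom.hom.hom 2 hA2 = dC • hA2)
    (hB : complexBetti.map ψ.hom.hom.hom 2 hB2 = dC • hB2) :
    complexBetti.map (AbelianVariety.prodLift (AbelianVariety.fst A B ≫ φ) (AbelianVariety.snd A B ≫ ψ)).hom.hom.hom 2
      (complexBetti.map (AbelianVariety.fst A B).hom.hom.hom 2 hA2 +
        complexBetti.map (AbelianVariety.snd A B).hom.hom.hom 2 hB2) =
    dC • (complexBetti.map (AbelianVariety.fst A B).hom.hom.hom 2 hA2 +
        complexBetti.map (AbelianVariety.snd A B).hom.hom.hom 2 hB2) := by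
  rw [map_add, map_prodLift_map_fst, map_prodLift_map_snd, hA, hB]
  simp only [map_smul, smul_add]

/-- **`ψ = (ψ₀, -ψ₀)` multiplies the weighted product class of `E × E` by `d`**:
`ψ^*(pr₁^*(c₁ η) + pr₂^*(c₂ η)) = d · (pr₁^*(c₁ η) + pr₂^*(c₂ η))` (`(±ψ₀)^* = d` on the line `H²(E)`,
the determinant of `±ψ₀^*|_{H¹}`, `HodgeTheory.cmCurve_map_two`). [cite: vanGeemen1994HodgeAV, Lemma 5.3] -/
theorem af_partner_symm {E : AbelianVariety ℂ} {d : ℕ} (hE : E.dim = 1) (hd : 0 < d) {ψ₀ : E ⟶ E}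
    (hψ : ψ₀ ≫ ψ₀ = -(d • 𝟙 E)) (η : complexBetti E.X 2) (c₁ c₂ : ℂ) :
    complexBetti.map (AbelianVariety.prodLift (AbelianVariety.fst E E ≫ ψ₀)
        (AbelianVariety.snd E E ≫ (-ψ₀))).hom.hom.hom 2
      (complexBetti.map (AbelianVariety.fst E E).hom.hom.hom 2 (c₁ • η) +
        complexBetti.map (AbelianVariety.snd E E).hom.hom.hom 2 (c₂ • η)) =
    (d : ℂ) • (complexBetti.map (AbelianVariety.fst E E).hom.hom.hom 2 (c₁ • η) +
        complexBetti.map (AbelianVariety.snd E E).hom.hom.hom 2 (c₂ • η)) := by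
  have hψ' : (-ψ₀) ≫ (-ψ₀) = -(d • 𝟙 E) := by rw [Preadditive.neg_comp_neg, hψ]
  have h1 : complexBetti.map ψ₀.hom.hom.hom 2 (c₁ • η) = (d : ℂ) • (c₁ • η) := by
    rw [map_smul, (cmCurve_map_two hE hd hψ η : complexBetti.map ψ₀.hom.hom.hom 2 η = (d : ℂ) • η),
      smul_comm]
  have h2 : complexBetti.map (-ψ₀).hom.hom.hom 2 (c₂ • η) = (d : ℂ) • (c₂ • η) := by
    rw [map_smul, (cmCurve_map_two hE hd hψ' η : complexBetti.map (-ψ₀).hom.hom.hom 2 η = (d : ℂ) • η),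
      smul_comm]
  exact af_product_symm _ _ h1 h2

/-- The top power of a class of the curve in exponent-`0` form: `L⁰_{c η} (c η) = c • η`. [folklore] -/
theorem af_top_curve {E : AbelianVariety ℂ} (η : complexBetti E.X 2) (c : ℚ) :
    lefschetzPow (((c : ℚ) : ℂ) • η) 0 2 (((c : ℚ) : ℂ) • η) = ((c : ℚ) : ℂ) • η := by
  simp [lefschetzPow_zero]

/-- **The rational degree-one model of a `K`-symmetrically polarised Weil pair is of Weil type,
alternating, with `M_A² = -d`, on `4n` vectors** (van Geemen, LNM 1594, 4.9 and Lemma 5.2 (2):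
`(√-d)^* E = d E`; the Gram matrix of `Q_h(uᵢ, uⱼ) = h^{2n-1} ⌣ uᵢ ⌣ uⱼ` is alternating by graded
commutativity; `(φ^*)² = -d` on `H¹`; `b₁(A) = 2 dim A`). The four hypotheses `hWA`, `hGAt`, `hMA`, `hcard`
of `Motives.exists_isotropic_blockVectors'`, in its bilinear (`mulVec`/`⬝ᵥ`) form.
[cite: vanGeemen1994HodgeAV, 4.9 and Lemma 5.2 (2)] [cite: LangeBirkenhake1992, Prop. 1.1.9 and Lemma 1.1.17] -/
theorem af_weilModel {n d : ℕ} {A : AbelianVariety ℂ} {φ : A ⟶ A} (hd : 0 < d) (hn : 1 ≤ n)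
    (hA : A.dim = 2 * n) (hφ : φ ≫ φ = -(d • 𝟙 A)) {h : complexBetti A.X 2}
    (hh : complexBetti.map φ.hom.hom.hom 2 h = (d : ℂ) • h) {r : ℕ} {u : Fin r → complexBetti A.X 1}
    (hui : LinearIndependent ℂ u) (hus : Submodule.span ℂ (Set.range u) = ⊤) {MA : Matrix (Fin r) (Fin r) ℚ}
    (hMA : ∀ i, complexBetti.map φ.hom.hom.hom 1 (u i) = ∑ j, ((MA j i : ℚ) : ℂ) • u j)
    {ω : complexBetti A.X (2 + 2 * (2 * n - 1))} (hω0 : ω ≠ 0) {GA : Matrix (Fin r) (Fin r) ℚ}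
    (hGA : ∀ i j, polarizationPairingOne A.X h (2 * n - 1) (u i) (u j) = ((GA i j : ℚ) : ℂ) • ω) :
    (∀ v w : Fin r → ℚ, MA.mulVec v ⬝ᵥ GA.mulVec (MA.mulVec w) = d * (v ⬝ᵥ GA.mulVec w)) ∧
    (∀ v w : Fin r → ℚ, w ⬝ᵥ GA.mulVec v = -(v ⬝ᵥ GA.mulVec w)) ∧
    (∀ v : Fin r → ℚ, MA.mulVec (MA.mulVec v) = -((d : ℚ) • v)) ∧
    Fintype.card (Fin r) = 4 * n := by
  have hA' : A.dim = (2 * n - 1) + 1 := by rw [hA]; omega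
  refine ⟨fun v w => ?_, af_antisymm_mulVec_of_entries GA (gram_antisymm _ _ u hω0 GA hGA), fun v => ?_, ?_⟩
  · exact af_weil_mulVec_of_entries MA GA (d : ℚ) (gram_map_eq_mul_gram hA'
      (abelianVarietyCohomologyExteriorH1_holds.finrank_one A)
      (abelianVarietyCohomologyExteriorH1_holds.span_range_cupPowOne A (2 + 2 * (2 * n - 1)))
      hd hφ hh u MA hMA hω0 GA hGA) v w
  · have e := af_mulVec_mulVec_of_frame (complexBetti.map φ.hom.hom.hom 1).hom u hui MA hMA (-(d : ℚ))
      (fun i => ?_) v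
    · rw [e, neg_smul]
    · have h2 := complexBetti_map_map_one_of_comp_self hφ (u i)
      change complexBetti.map φ.hom.hom.hom 1 (complexBetti.map φ.hom.hom.hom 1 (u i)) = _
      rw [h2]
      push_cast
      rw [neg_smul]
  · have h1 := finrank_span_eq_card (R := ℂ) hui
    rw [hus, finrank_top, abelianVarietyCohomologyExteriorH1_holds.finrank_one A, hA] at h1
    omega

end Models

/-! ## (AIM) for `n ≥ 1`: the assembly -/

/-- **The aiming (AIM) of the CM square for `n ≥ 1`** (Markman, arXiv:2509.23403 §11.5 Step 2; van
Geemen, LNM 1594, Lemma 5.2 (2)–(6), 5.3, 5.4 (5.4.1); Schoen 1998 §10). Let `(E₀, ψ₀)` be a complex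
elliptic curve with `ψ₀ ≫ ψ₀ = -(d • 𝟙)` (`d ≥ 1`), and `(A, φ)` a complex abelian `2n`-fold (`n ≥ 1`)
with `φ ≫ φ = -(d • 𝟙)` whose Weil plane `weilClassesOf A φ n d` contains a NON-ZERO rational class of
Hodge type `(n, n)`. Then `A × (E₀ × E₀)` with `Ψ = φ × (ψ₀ × (-ψ₀))` has a projective embedding `e` and a
rational `a ≠ 0` for which `(A × (E₀ × E₀), Ψ)` is of HYPERBOLIC Weil type in half-dimension `n + 1` for
the `K`-symmetrised hyperplane class `d·e^*a + Ψ^*e^*a`. Proof, on the carriers: the CM partner model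
`(v, ψ₀^*v)`, `M_E = ((0,-d),(1,0))`, `G_E = ((0,1),(-1,0))`, `η₀ = v ⌣ ψ₀^*v` (`cmCurve_rationalModel`);
the `K`-symmetric Segre data (`exists_symmetricSegreEmbedding` at `η₀`) `e_A, a_A, s` with `h_A = e_A^*a_A`,
`φ^* h_A = d h_A`; the multiplicities `(n, n)` (`weilMultiplicity_of_mem_weilClassesOf`), Hodge–Riemann in
degree one for `h_A` (`hodgeRiemann_degreeOne_of_isOfHodgeType`) and the signature
(`weilSignature_exists_PN`) of the rational model `(u, M_A, ω_A, G_A, d_A)` of `(A, φ, h_A)`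
(`exists_rationalModel_one`), of Weil type, alternating, `M_A² = -d`, `4n` vectors (`af_weilModel`);
`exists_isotropic_blockVectors'` with the weights `κ₁ = C(2n+1, 2n-1)·C(2,1)·s²`,
`κ₂ = C(2n+1, 2n)·d_A·s` yields `m₁, m₂ > 0` and the isotropic block vectors; the embedding at `(m₁, m₂)`
has `e^*a = pr_A^* h_A + pr_B^* h_B`, `h_B = pr₁^*(s m₁ η₀) + pr₂^*(s m₂ η₀)`, the `K`-symmetrised class is
`2d · e^*a` (`af_product_symm`, `af_partner_symm`), and the product frame
`isHyperbolicWeilType_prod_of_rationalModels` (`polarizationPairingOne_sumElim`,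
`lefschetzPow_add_map_self`, `map_prodLift_sumElim`) with `isHyperbolicWeilType_smul_iff` concludes.
[cite: Markman2025SurveySecant, §11.5 Step 2] [cite: vanGeemen1994HodgeAV, Lemma 5.2 (2)–(6), 5.3 and 5.4 (5.4.1)]
[cite: Schoen1998HodgeWeilAddendum, §10] -/
theorem aimedSplitProduct_cmSquare_of_pos {d : ℕ} (hd : 0 < d) {E₀ : AbelianVariety ℂ} {ψ₀ : E₀ ⟶ E₀}
    (hE : E₀.dim = 1) (hψ : ψ₀ ≫ ψ₀ = -(d • 𝟙 E₀)) {n : ℕ} (hn : 0 < n) {A : AbelianVariety ℂ}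
    {φ : A ⟶ A} (hA : A.dim = 2 * n) (hφ : φ ≫ φ = -(d • 𝟙 A))
    (hweil : ∃ c : complexBetti A.X (2 * n), IsRationalClass c ∧
      IsOfHodgeType (2 * n) A.X (2 * n) n n c ∧ c ∈ weilClassesOf A φ n d ∧ c ≠ 0) :
    ∃ (e : ProjectiveEmbedding (A.prod (E₀.prod E₀)).X) (a : complexBetti (projectiveSpace e.n ℂ) 2),
      IsRationalClass a ∧ a ≠ 0 ∧
      IsHyperbolicWeilType (A.prod (E₀.prod E₀))
        (AbelianVariety.prodLift (AbelianVariety.fst A (E₀.prod E₀) ≫ φ)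
          (AbelianVariety.snd A (E₀.prod E₀) ≫
            AbelianVariety.prodLift (AbelianVariety.fst E₀ E₀ ≫ ψ₀) (AbelianVariety.snd E₀ E₀ ≫ (-ψ₀))))
        (n + 1)
        ((d : ℂ) • complexBetti.map e.ι 2 a +
          complexBetti.map (AbelianVariety.prodLift (AbelianVariety.fst A (E₀.prod E₀) ≫ φ)
            (AbelianVariety.snd A (E₀.prod E₀) ≫
              AbelianVariety.prodLift (AbelianVariety.fst E₀ E₀ ≫ ψ₀)
                (AbelianVariety.snd E₀ E₀ ≫ (-ψ₀)))).hom.hom.hom 2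
            (complexBetti.map e.ι 2 a)) := by
  classical
  -- dimension bookkeeping
  have hA' : A.dim = (2 * n - 1) + 1 := by rw [hA]; omega
  have hE' : E₀.dim = 0 + 1 := hE
  have hB' : (E₀.prod E₀).dim = 1 + 1 := by rw [AbelianVariety.dim_prod, hE]
  have hN : 2 * (n + 1) = (2 * n - 1) + 1 + 2 := by omega
  have hX : IsSmoothProjective (2 * n) A.X := isSmoothProjective_of_dim_eq' hA
  have hX' : IsSmoothProjective ((2 * n - 1) + 1) A.X := isSmoothProjective_of_dim_eq' hA'
  have hdC : (d : ℂ) + d ≠ 0 := by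
    rw [← Nat.cast_add]; exact Nat.cast_ne_zero.2 (by omega)
  have hdQ : (0 : ℚ) < d := by exact_mod_cast hd
  -- (1) the CM partner model `(v, ψ₀^* v)`, `M_E`, `G_E`, `η₀ = ω_E`
  obtain ⟨x, η₀, hxr, hxi, _hxs, hMx, hnMx, hη₀r, hη₀0, hgram, _htop, _hψ2, _hnψ2⟩ :=
    cmCurve_rationalModel hE hd hψ
  change complexBetti E₀.X 2 at η₀
  -- (2) the `K`-symmetric Segre data (β) for `η₀`
  obtain ⟨eA, aA, s, haA, haA0, hsym, hemb⟩ := exists_symmetricSegreEmbedding hd hφ E₀ hE η₀ hη₀r hη₀0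
  have hhAr : IsRationalClass (complexBetti.map eA.ι 2 aA) := haA.map _
  -- (3) multiplicities (α₁), the rational model of `(A, φ, h_A)`, Hodge–Riemann, its signature (α₂)
  obtain ⟨c, _hcr, hct, hcw, hc0⟩ := hweil
  obtain ⟨hmp, hmm⟩ := weilMultiplicity_of_mem_weilClassesOf hn hd hA hφ hcw hc0 hct
  rw [hodgeOneZero_eq_of_eq hX hX' (by omega)] at hmp hmm
  obtain ⟨r, u, MA, ωA, GA, dA, hur, hui, hus, hMA, hωAr, hωA0, hGA, hdA⟩ :=
    exists_rationalModel_one φ hA' (complexBetti.map eA.ι 2 aA) hhAr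
  have hHR := hodgeRiemann_degreeOne_of_isOfHodgeType hX' eA haA haA0
  have hPN := weilSignature_exists_PN hd hA' hφ hmp hmm hsym hHR u hur hui hus MA hMA ωA GA hωAr hωA0 hGA
  -- the model is of Weil type and alternating, `M_A² = -d`, on `4n` vectors
  obtain ⟨hWA, hGAt, hMA2, hcard⟩ := af_weilModel hd hn hA hφ hsym hui hus hMA hωA0 hGA
  -- (4) the binary partner `(M_E, G_E, e₀)` and (5) the isotropic block vectors
  obtain ⟨m₁, m₂, hm₁, hm₂, b, hb, hbM, hbG⟩ := exists_isotropic_blockVectors' hdQ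
    MA hMA2 GA hGAt hWA n hcard hPN (!![(0 : ℚ), -(d : ℚ); 1, 0]) (af_ME_mulVec_mulVec (d : ℚ))
    !![0, 1; -1, 0] af_GE_antisymm (Pi.single 0 1) (by simp)
    ((((2 * (n + 1) - 1).choose (2 * n - 1) : ℕ) : ℚ) * (((1 + 1).choose (0 + 1) : ℕ) : ℚ) * s * s)
    ((((2 * (n + 1) - 1).choose (2 * n - 1 + 1) : ℕ) : ℚ) * dA * s)
  -- (6) the embedding at these weights (β)
  obtain ⟨e, a, ha, ha0, he⟩ := hemb m₁ m₂ hm₁ hm₂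
  refine ⟨e, a, ha, ha0, ?_⟩
  -- (7) `e^*a = pr_A^* h_A + pr_B^* h_B` and its `K`-symmetrisation `2d · e^*a`
  have he' : complexBetti.map e.ι 2 a =
      complexBetti.map (AbelianVariety.fst A (E₀.prod E₀)).hom.hom.hom 2 (complexBetti.map eA.ι 2 aA) +
        complexBetti.map (AbelianVariety.snd A (E₀.prod E₀)).hom.hom.hom 2
          (complexBetti.map (AbelianVariety.fst E₀ E₀).hom.hom.hom 2
              ((((s * m₁ : ℚ)) : ℂ) • η₀) +
            complexBetti.map (AbelianVariety.snd E₀ E₀).hom.hom.hom 2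
              ((((s * m₂ : ℚ)) : ℂ) • η₀)) := by
    rw [he]
    congr 1
    simp only [map_add, map_smul, smul_add, smul_smul]
    push_cast
    rfl
  have hΨ := af_product_symm (dC := (d : ℂ)) φ _ hsym
    (af_partner_symm hE hd hψ η₀ (((s * m₁ : ℚ)) : ℂ) (((s * m₂ : ℚ)) : ℂ))
  rw [he', hΨ, ← add_smul, isHyperbolicWeilType_smul_iff hdC]
  -- (8) the product frame from the two rational models and the block vectors
  have htop : ∀ c : ℚ, lefschetzPow (((c : ℚ) : ℂ) • η₀) 0 2 (((c : ℚ) : ℂ) • η₀) = ((c : ℚ) : ℂ) • η₀ :=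
    fun c => af_top_curve η₀ c
  have hGB := polarizationPairingOne_sumElim hE' hE' (m := 1) rfl x x
    ((((s * m₁ : ℚ)) : ℂ) • η₀) η₀ _ (hgram _) (s * m₁) (htop _)
    ((((s * m₂ : ℚ)) : ℂ) • η₀) η₀ _ (hgram _) (s * m₂) (htop _)
  have hdB := lefschetzPow_add_map_self hE' hE' (m := 1) rfl
    ((((s * m₁ : ℚ)) : ℂ) • η₀) η₀ (s * m₁) (htop _)
    ((((s * m₂ : ℚ)) : ℂ) • η₀) η₀ (s * m₂) (htop _)
  refine isHyperbolicWeilType_prod_of_rationalModels φ _ hA' hB' hN u hur hui MA hMA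
    (Sum.elim (fun i => complexBetti.map (AbelianVariety.fst E₀ E₀).hom.hom.hom 1 (x i))
      (fun i => complexBetti.map (AbelianVariety.snd E₀ E₀).hom.hom.hom 1 (x i)))
    ?_ (linearIndependent_sumElim_map_fst_map_snd hxi hxi)
    (Matrix.fromBlocks (!![(0 : ℚ), -(d : ℚ); 1, 0]) 0 0 (-!![(0 : ℚ), -(d : ℚ); 1, 0]))
    (map_prodLift_sumElim ψ₀ (-ψ₀) x _ hMx x _ hnMx)
    (complexBetti.map eA.ι 2 aA) ωA GA hGA dA hdA _ _ _ hGB _ hdB b hb hbM ?_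
  · rintro (i | i)
    · exact (hxr i).map _
    · exact (hxr i).map _
  · intro k l
    refine Eq.trans (Finset.sum_congr rfl fun p _ => Finset.sum_congr rfl fun q _ => ?_) (hbG k l)
    congr 2
    rcases p with i | (j | j) <;> rcases q with i' | (j' | j') <;>
      simp only [Matrix.fromBlocks_apply₁₁, Matrix.fromBlocks_apply₁₂, Matrix.fromBlocks_apply₂₁,
        Matrix.fromBlocks_apply₂₂, Matrix.smul_apply, Matrix.zero_apply, smul_eq_mul, Nat.choose_zero_right,
        Nat.choose_self, Nat.choose_one_right, zero_add, Nat.cast_one, one_mul] <;> push_cast <;> ring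

/-! ## (AIM) for `n = 0`: the CM square alone, transported along a point factor -/

/-- **A point factor does not change hyperbolicity**: if `A` has dimension `0` and `(B, ψ)` is of
hyperbolic Weil type in half-dimension `N` for `h_B`, then `(A × B, φ × ψ)` is of hyperbolic Weil type in
half-dimension `N` for `pr_A^* h_A + pr_B^* h_B` (any `h_A`): `H²(A(ℂ); ℂ) = 0`, the frame `pr_B^* w` of a
hyperbolic frame `w` of `B` is rational, `ℂ`-independent (the section `(0, 𝟙)` splits `pr_B^*` on `H¹`),
`(φ × ψ)^*`-stable, and isotropic by naturality of the polarization pairing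
(`map_polarizationPairingOne`). [cite: vanGeemen1994HodgeAV, Lemma 5.2 and 5.4] -/
theorem isHyperbolicWeilType_prod_of_dim_eq_zero {A B : AbelianVariety ℂ} (hA : A.dim = 0)
    (φ : A ⟶ A) (ψ : B ⟶ B) {N : ℕ} {hB : complexBetti B.X 2} (h : IsHyperbolicWeilType B ψ N hB)
    (hA2 : complexBetti A.X 2) :
    IsHyperbolicWeilType (A.prod B)
      (AbelianVariety.prodLift (AbelianVariety.fst A B ≫ φ) (AbelianVariety.snd A B ≫ ψ)) N
      (complexBetti.map (AbelianVariety.fst A B).hom.hom.hom 2 hA2 +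
        complexBetti.map (AbelianVariety.snd A B).hom.hom.hom 2 hB) := by
  have hX : IsSmoothProjective 0 A.X := isSmoothProjective_of_dim_eq' hA
  haveI : Subsingleton (complexBetti A.X 2) :=
    ComplexPoints.subsingleton_singularCohomology_of_lt hX ℂ (k := 2) (by omega)
  have hA20 : hA2 = 0 := Subsingleton.elim _ _
  rw [hA20, map_zero, zero_add]
  obtain ⟨w, hwr, hwi, hws, hwQ⟩ := h
  set g := (AbelianVariety.snd A B).hom.hom.hom with hg
  refine ⟨fun k => complexBetti.map g 1 (w k), fun k => (hwr k).map _, ?_, fun k => ?_, fun k l => ?_⟩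
  · -- `ℂ`-independence: the section `(0, 𝟙)` splits `pr_B^*`
    refine LinearIndependent.of_comp
      (complexBetti.map (AbelianVariety.prodLift (0 : B ⟶ A) (𝟙 B)).hom.hom.hom 1).hom ?_
    have e : ((complexBetti.map (AbelianVariety.prodLift (0 : B ⟶ A) (𝟙 B)).hom.hom.hom 1).hom ∘
        fun k => complexBetti.map g 1 (w k)) = w :=
      funext fun k => map_inrSection_map_snd_one (w k)
    rw [e]
    exact hwi
  · -- stability
    rw [map_prodLift_map_snd]
    have hle : (Submodule.span ℂ (Set.range w)).map (complexBetti.map g 1).hom ≤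
        Submodule.span ℂ (Set.range fun k => complexBetti.map g 1 (w k)) := by
      rw [Submodule.map_span, ← Set.range_comp]
      rfl
    exact hle (Submodule.mem_map_of_mem (hws k))
  · -- isotropy by naturality
    rw [← map_polarizationPairingOne, hwQ, map_zero]

/-- **The equal-weight isotropic `K`-line of the CM square** (van Geemen 5.3 with `a = 1`: for
`m₁ = m₂` the `K`-Hermitian form `⟨1⟩ ⊥ ⟨-1⟩` of `(E₀ × E₀, (ψ₀, -ψ₀))` is hyperbolic). With
`M_E = ((0,-d),(1,0))`, `G_E = ((0,1),(-1,0))`, `e₀ = (1,0)`, `e₁ = M_E e₀ = (0,1)`: the two vectors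
`(e₀, e₀)`, `(e₁, -e₁)` of `ℚ² ⊕ ℚ²` are independent, span an `(M_E ⊕ -M_E)`-stable plane and are
isotropic for every block form `c G_E ⊕ c G_E`. [cite: vanGeemen1994HodgeAV, Lemma 5.3] -/
theorem cmSquare_equalWeight_blockVectors (d c : ℚ) :
    ∃ b : Fin (2 * 1) → (Fin 2 ⊕ Fin 2) → ℚ, LinearIndependent ℚ b ∧
      (∀ k, ∃ cf : Fin (2 * 1) → ℚ,
        (Matrix.fromBlocks (!![(0 : ℚ), -d; 1, 0]) 0 0 (-!![(0 : ℚ), -d; 1, 0])).mulVec (b k) =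
          ∑ l, cf l • b l) ∧
      (∀ k l, ∑ s, ∑ t, b k s *
        (Matrix.fromBlocks ((((2 * 1 - 1).choose 0 : ℚ) * c) • (!![0, 1; -1, 0] : Matrix (Fin 2) (Fin 2) ℚ)) 0 0
          ((((2 * 1 - 1).choose (0 + 1) : ℚ) * c) • (!![0, 1; -1, 0] : Matrix (Fin 2) (Fin 2) ℚ))) s t * b l t = 0) := by
  let b : Fin (2 * 1) → (Fin 2 ⊕ Fin 2) → ℚ :=
    ![Sum.elim ![1, 0] ![1, 0], Sum.elim ![0, 1] ![0, -1]]
  refine ⟨b, ?_, ?_, ?_⟩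
  · rw [Fintype.linearIndependent_iff]
    intro g hg k
    have h0 := congrFun hg (Sum.inl 0)
    have h1 := congrFun hg (Sum.inl 1)
    simp only [Finset.sum_apply, Pi.smul_apply, smul_eq_mul, Pi.zero_apply, b] at h0 h1
    fin_cases k
    · simpa using h0
    · simpa using h1
  · intro k
    fin_cases k
    · refine ⟨![0, 1], ?_⟩
      funext t
      rcases t with i | i <;> fin_cases i <;>
        simp [b, Matrix.mulVec, dotProduct, Fintype.sum_sum_type, Fin.sum_univ_two, Matrix.fromBlocks]
    · refine ⟨![-d, 0], ?_⟩
      funext t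
      rcases t with i | i <;> fin_cases i <;>
        simp [b, Matrix.mulVec, dotProduct, Fintype.sum_sum_type, Fin.sum_univ_two, Matrix.fromBlocks]
  · intro k l
    fin_cases k <;> fin_cases l <;>
      simp [b, Fintype.sum_sum_type, Fin.sum_univ_two, Matrix.fromBlocks]

/-- **The aiming (AIM) of the CM square for `n = 0`** (`A` a point): the CM square
`(E₀ × E₀, (ψ₀, -ψ₀))` with the `K`-symmetrised hyperplane class of an EQUAL-WEIGHT Segre embedding is
of hyperbolic Weil type in half-dimension `1` (van Geemen 5.3, `a = 1`: the isotropic `K`-line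
`{(v, v), (ψ₀^*v, -ψ₀^*v)}`; `cmSquare_equalWeight_blockVectors` and
`isHyperbolicWeilType_prod_of_rationalModels` for `E₀ × E₀`), and the point factor `A` is harmless
(`isHyperbolicWeilType_prod_of_dim_eq_zero`). [cite: vanGeemen1994HodgeAV, Lemma 5.3 and 5.4 (5.4.1)]
[cite: Markman2025SurveySecant, §11.5 Step 2] -/
theorem aimedSplitProduct_cmSquare_of_dim_eq_zero {d : ℕ} (hd : 0 < d) {E₀ : AbelianVariety ℂ}
    {ψ₀ : E₀ ⟶ E₀} (hE : E₀.dim = 1) (hψ : ψ₀ ≫ ψ₀ = -(d • 𝟙 E₀)) {A : AbelianVariety ℂ}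
    (φ : A ⟶ A) (hA : A.dim = 0) (hφ : φ ≫ φ = -(d • 𝟙 A)) :
    ∃ (e : ProjectiveEmbedding (A.prod (E₀.prod E₀)).X) (a : complexBetti (projectiveSpace e.n ℂ) 2),
      IsRationalClass a ∧ a ≠ 0 ∧
      IsHyperbolicWeilType (A.prod (E₀.prod E₀))
        (AbelianVariety.prodLift (AbelianVariety.fst A (E₀.prod E₀) ≫ φ)
          (AbelianVariety.snd A (E₀.prod E₀) ≫
            AbelianVariety.prodLift (AbelianVariety.fst E₀ E₀ ≫ ψ₀) (AbelianVariety.snd E₀ E₀ ≫ (-ψ₀))))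
        1
        ((d : ℂ) • complexBetti.map e.ι 2 a +
          complexBetti.map (AbelianVariety.prodLift (AbelianVariety.fst A (E₀.prod E₀) ≫ φ)
            (AbelianVariety.snd A (E₀.prod E₀) ≫
              AbelianVariety.prodLift (AbelianVariety.fst E₀ E₀ ≫ ψ₀)
                (AbelianVariety.snd E₀ E₀ ≫ (-ψ₀)))).hom.hom.hom 2
            (complexBetti.map e.ι 2 a)) := by
  classical
  have hE' : E₀.dim = 0 + 1 := hE
  have hdC : (d : ℂ) + d ≠ 0 := by
    rw [← Nat.cast_add]; exact Nat.cast_ne_zero.2 (by omega)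
  -- the CM partner model and the Segre data at weights `(1, 1)`
  obtain ⟨x, η₀, hxr, hxi, _hxs, hMx, hnMx, hη₀r, hη₀0, hgram, _htop, _hψ2, _hnψ2⟩ :=
    cmCurve_rationalModel hE hd hψ
  change complexBetti E₀.X 2 at η₀
  obtain ⟨eA, aA, s, _haA, _haA0, hsym, hemb⟩ := exists_symmetricSegreEmbedding hd hφ E₀ hE η₀ hη₀r hη₀0
  obtain ⟨e, a, ha, ha0, he⟩ := hemb 1 1 one_pos one_pos
  refine ⟨e, a, ha, ha0, ?_⟩
  have he' : complexBetti.map e.ι 2 a =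
      complexBetti.map (AbelianVariety.fst A (E₀.prod E₀)).hom.hom.hom 2 (complexBetti.map eA.ι 2 aA) +
        complexBetti.map (AbelianVariety.snd A (E₀.prod E₀)).hom.hom.hom 2
          (complexBetti.map (AbelianVariety.fst E₀ E₀).hom.hom.hom 2 ((((s * 1 : ℚ)) : ℂ) • η₀) +
            complexBetti.map (AbelianVariety.snd E₀ E₀).hom.hom.hom 2 ((((s * 1 : ℚ)) : ℂ) • η₀)) := by
    rw [he]
    congr 1
    simp only [map_add, map_smul, smul_add, smul_smul]
    push_cast
    simp
  have hΨ := af_product_symm (dC := (d : ℂ)) φ _ hsym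
    (af_partner_symm hE hd hψ η₀ (((s * 1 : ℚ)) : ℂ) (((s * 1 : ℚ)) : ℂ))
  rw [he', hΨ, ← add_smul, isHyperbolicWeilType_smul_iff hdC]
  refine isHyperbolicWeilType_prod_of_dim_eq_zero hA φ _ ?_ _
  -- the CM square alone: product frame of `E₀ × E₀` with the equal-weight isotropic `K`-line
  have htop : ∀ c : ℚ, lefschetzPow (((c : ℚ) : ℂ) • η₀) 0 2 (((c : ℚ) : ℂ) • η₀) = ((c : ℚ) : ℂ) • η₀ :=
    fun c => af_top_curve η₀ c
  obtain ⟨b, hb, hbM, hbG⟩ := cmSquare_equalWeight_blockVectors (d : ℚ) (s * 1)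
  exact isHyperbolicWeilType_prod_of_rationalModels ψ₀ (-ψ₀) hE' hE' (N := 1) rfl x hxr hxi _ hMx x hxr hxi _
    hnMx ((((s * 1 : ℚ)) : ℂ) • η₀) η₀ _ (hgram _) (s * 1) (htop _)
    ((((s * 1 : ℚ)) : ℂ) • η₀) η₀ _ (hgram _) (s * 1) (htop _) b hb hbM hbG

/-! ## The discharge -/

/-- **(AIM) for one CM curve per `d`.** For every `d ≥ 1` the CM curve `E₀ = ℂ/(ℤ + ℤ·i√d)` with
`ψ₀ = [√-d]`, `ψ₀ ≫ ψ₀ = -(d • 𝟙)` (`CMEndomorphism.exists_cmCurve_sqrt_neg`, Silverman AEC VI.4.1 (b))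
has the aiming property of `exists_cmWeilSurface_aimedSplitProduct_of_ne_one_of_ne_three_of_exists_aimedCmCurve`:
`aimedSplitProduct_cmSquare_of_pos` (`n ≥ 1`) and `aimedSplitProduct_cmSquare_of_dim_eq_zero` (`n = 0`).
[cite: Markman2025SurveySecant, §11.5 Step 2] [cite: vanGeemen1994HodgeAV, Lemma 5.2 (2)–(6), 5.3 and 5.4 (5.4.1)]
[cite: SilvermanAEC2009, Thm. VI.4.1 (b)] -/
theorem exists_aimedCmCurve (d : ℕ) (hd : 0 < d) :
    ∃ (E₀ : AbelianVariety ℂ) (ψ₀ : E₀ ⟶ E₀), E₀.dim = 1 ∧ ψ₀ ≫ ψ₀ = -(d • 𝟙 E₀) ∧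
      ∀ (n : ℕ) (A : AbelianVariety ℂ) (φ : A ⟶ A), A.dim = 2 * n → φ ≫ φ = -(d • 𝟙 A) →
        (∃ c : complexBetti A.X (2 * n), IsRationalClass c ∧
          IsOfHodgeType (2 * n) A.X (2 * n) n n c ∧ c ∈ weilClassesOf A φ n d ∧ c ≠ 0) →
        ∃ (e : ProjectiveEmbedding (A.prod (E₀.prod E₀)).X)
          (a : complexBetti (projectiveSpace e.n ℂ) 2), IsRationalClass a ∧ a ≠ 0 ∧
          IsHyperbolicWeilType (A.prod (E₀.prod E₀))
            (AbelianVariety.prodLift (AbelianVariety.fst A (E₀.prod E₀) ≫ φ)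
              (AbelianVariety.snd A (E₀.prod E₀) ≫
                AbelianVariety.prodLift (AbelianVariety.fst E₀ E₀ ≫ ψ₀)
                  (AbelianVariety.snd E₀ E₀ ≫ (-ψ₀))))
            (n + 1)
            ((d : ℂ) • complexBetti.map e.ι 2 a +
              complexBetti.map (AbelianVariety.prodLift (AbelianVariety.fst A (E₀.prod E₀) ≫ φ)
                (AbelianVariety.snd A (E₀.prod E₀) ≫
                  AbelianVariety.prodLift (AbelianVariety.fst E₀ E₀ ≫ ψ₀)
                    (AbelianVariety.snd E₀ E₀ ≫ (-ψ₀)))).hom.hom.hom 2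
                (complexBetti.map e.ι 2 a)) := by
  obtain ⟨E₀, ψ₀, hE, hψ⟩ := Literature.NumberTheory.EllipticCurves.CMEndomorphism.exists_cmCurve_sqrt_neg d hd
  refine ⟨E₀, ψ₀, hE, hψ, fun n A φ hA hφ hweil => ?_⟩
  rcases Nat.eq_zero_or_pos n with rfl | hn
  · exact aimedSplitProduct_cmSquare_of_dim_eq_zero hd hE hψ φ (by omega) hφ
  · exact aimedSplitProduct_cmSquare_of_pos hd hE hψ hn hA hφ hweil

/-- **Discharge of the aiming lemma `exists_cmWeilSurface_aimedSplitProduct_of_ne_one_of_ne_three`**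
(Markman, arXiv:2509.23403 §11.5 Step 2; van Geemen, LNM 1594, Lemma 5.2 (2)–(6), 5.3, 5.4 (5.4.1); Schoen
1998 §10): for every `d ≥ 1`, `d ∉ {1, 3}`, the CM square `B = E₀ × E₀`, `ψ = (ψ₀, -ψ₀)` with its
descent pair (`Motives/CMSquareDescentPair`) aims every Weil-type `(A, φ)` — the reduction
`exists_cmWeilSurface_aimedSplitProduct_of_ne_one_of_ne_three_of_exists_aimedCmCurve` of
`Motives/AimedSplitProductCMSquare` fed with `exists_aimedCmCurve`. Relies on: nothing unproved.
[cite: Markman2025SurveySecant, §11.5 Step 2] [cite: vanGeemen1994HodgeAV, Lemma 5.2 (2)–(6), 5.3 and 5.4 (5.4.1)]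
[cite: Schoen1998HodgeWeilAddendum, §10 (proof of the Proposition)] -/
theorem exists_cmWeilSurface_aimedSplitProduct_of_ne_one_of_ne_three_holds :
    exists_cmWeilSurface_aimedSplitProduct_of_ne_one_of_ne_three :=
  exists_cmWeilSurface_aimedSplitProduct_of_ne_one_of_ne_three_of_exists_aimedCmCurve
    fun d hd _ _ ↦ exists_aimedCmCurve d hd

end Literature.AlgebraicGeometry.Motives

end
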